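import Literature.Topology.FourManifolds.TubeRadial
import Literature.Topology.FourManifolds.TubeConeify
import Literature.Topology.FourManifolds.TubeRound
import Literature.Topology.FourManifolds.TubeFlatten
import Literature.Topology.FourManifolds.TubePacing
import HarnessLib

/-!
# The tube stage map: assembling the zones by radius

Topic `Literature/Topology/FourManifolds`; Euclidean analysis in `E × F` assembling the zone maps
of the codimension `≥ 2` step of the smoothing of PD homeomorphisms (Munkres, Ann. of Math. 72
(1960), §§4–5; Campbell–D'Onofrio–Vítek, J. Geom. Anal. (2026), Lemmas 3.2, 3.4) into ONE map.
For a stage map `u = (T, N)` on `E × F`, a stage radius `r > 0`, a round radius `ρ`, a unit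
family `Ψ` with pacing `λ` (the untwist data below the round zone), the **tube stage map** is

* `t ≥ r/2`   : `flattenStageMap T N (flattenCutoff r)` — equal to `u` for `t ≥ 7r/8` and to
  `(x, N)` for `t ≤ 5r/8` (`TubeFlatten.lean`);
* `r/4 ≤ t < r/2` : `coneifyStageMap N (stagePacing r)` — equal to `(x, N)` for `t ≥ 7r/16` and
  to the exact cone `(x, t • V)`, `V = linkField N (r/4)`, for `t ≤ 5r/16` (`TubeConeify.lean`);
* `r/8 ≤ t < r/4` : `roundStageMap N (r/4) ρ (roundCutoff r)` — the exact cone for `t ≥ 7r/32`,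
  the round cone `(x, (ρt) • V/‖V‖)` for `t ≤ 5r/32` (`TubeRound.lean`);
* `t < r/8`   : `radialStageMap ρ Ψ λ` — the round cone while `λ ≥ 2` (i.e. for `t ≥ 3r/32`),
  then the untwist zones and the linear core (`TubeRadial.lean`),

(`t = ‖y‖`; all ratios are fixed, so every derivative of a cutoff costs a universal constant over
`r`).  This file defines the map (`tubeStageMap`), proves the **zone and plateau identities**
(what the map is on each annulus, and that adjacent formulas AGREE on the overlap annuli
`(7r/16, 5r/8)`, `(7r/32, 5r/16)`, `(3r/32, 5r/32)`), and the **smoothness** of the assembled map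
on `V × B(0, r)` from the smoothness of `u` on the closed shell `r/4 ≤ t ≤ r` (and of `T` only
on `5r/8 ≤ t ≤ r`), of the unit family off the zero section, and the linear core
(`contDiffAt_tubeStageMap`).  Nondegeneracy and exports are treated in the sequel.  Definitions
are explicit functions; no named facts.

## References

* J. R. Munkres, *Obstructions to the smoothing of piecewise-differentiable homeomorphisms*, Ann.
  of Math. (2) 72 (1960), 521–554, §§4–5. [Munkres1960]
* D. Campbell, L. D'Onofrio, T. Vítek, *Diffeomorphic approximation of piecewise affine
  homeomorphisms*, J. Geom. Anal. 36 (2026), Lemmas 3.2, 3.4. [CampbellDonofrioVitek2026]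
-/

noncomputable section

open Set Function Metric Filter
open scoped Topology ContDiff RealInnerProductSpace

namespace Literature.Topology.FourManifolds

variable {E : Type*} [NormedAddCommGroup E] [NormedSpace ℝ E]
variable {F : Type*} [NormedAddCommGroup F] [InnerProductSpace ℝ F]

/-! ### The cutoffs of a stage of radius `r` -/

/-- The flatten cutoff: `0` below `5r/8`, `1` above `7r/8`. [folklore] -/
def flattenCutoff (r : ℝ) : ℝ → ℝ := rampCutoff (5 * r / 8) (7 * r / 8)

/-- The cone pacing of the stage: `≡ r/4` below `5r/16`, `= t` above `7r/16`. [folklore] -/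
def stagePacing (r : ℝ) : ℝ → ℝ := conePacing (5 * r / 16) (7 * r / 16) (r / 4)

/-- The round cutoff: `0` below `5r/32`, `1` above `7r/32`. [folklore] -/
def roundCutoff (r : ℝ) : ℝ → ℝ := rampCutoff (5 * r / 32) (7 * r / 32)

section Cutoffs

variable {r : ℝ}

/-- [folklore] -/
theorem flattenCutoff_of_le (hr : 0 < r) {t : ℝ} (ht : t ≤ 5 * r / 8) : flattenCutoff r t = 0 :=
  rampCutoff_of_le (by linarith) ht

/-- [folklore] -/
theorem flattenCutoff_of_ge (hr : 0 < r) {t : ℝ} (ht : 7 * r / 8 ≤ t) : flattenCutoff r t = 1 :=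
  rampCutoff_of_ge (by linarith) ht

/-- [folklore] -/
theorem contDiff_flattenCutoff (r : ℝ) : ContDiff ℝ ∞ (flattenCutoff r) := contDiff_rampCutoff _ _

/-- [folklore] -/
theorem stagePacing_of_le (hr : 0 < r) {t : ℝ} (ht : t ≤ 5 * r / 16) : stagePacing r t = r / 4 :=
  conePacing_of_le (by linarith) ht

/-- [folklore] -/
theorem stagePacing_of_ge (hr : 0 < r) {t : ℝ} (ht : 7 * r / 16 ≤ t) : stagePacing r t = t :=
  conePacing_of_ge (by linarith) ht

/-- [folklore] -/
theorem contDiff_stagePacing (r : ℝ) : ContDiff ℝ ∞ (stagePacing r) := contDiff_conePacing _ _ _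

/-- The stage pacing is positive on `t ≥ r/4 > 0`. [folklore] -/
theorem stagePacing_pos (hr : 0 < r) {t : ℝ} (ht : r / 4 ≤ t) : 0 < stagePacing r t :=
  conePacing_pos (by linarith) ht

/-- The stage pacing reads radii in `[r/4, t]`. [folklore] -/
theorem stagePacing_mem_Icc {t : ℝ} (ht : r / 4 ≤ t) : stagePacing r t ∈ Icc (r / 4) t :=
  conePacing_mem_Icc ht

/-- [folklore] -/
theorem roundCutoff_of_le (hr : 0 < r) {t : ℝ} (ht : t ≤ 5 * r / 32) : roundCutoff r t = 0 :=
  rampCutoff_of_le (by linarith) ht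

/-- [folklore] -/
theorem roundCutoff_of_ge (hr : 0 < r) {t : ℝ} (ht : 7 * r / 32 ≤ t) : roundCutoff r t = 1 :=
  rampCutoff_of_ge (by linarith) ht

/-- [folklore] -/
theorem contDiff_roundCutoff (r : ℝ) : ContDiff ℝ ∞ (roundCutoff r) := contDiff_rampCutoff _ _

/-- [folklore] -/
theorem roundCutoff_mem_Icc (r t : ℝ) : roundCutoff r t ∈ Icc (0 : ℝ) 1 := rampCutoff_mem_Icc _ _ _

/-- [folklore] -/
theorem monotone_roundCutoff (hr : 0 < r) : Monotone (roundCutoff r) := monotone_rampCutoff (by linarith)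

end Cutoffs

/-! ### The assembled stage map -/

/-- **The tube stage map** of radius `r` (see the module docstring for the zones).
[cite: CampbellDonofrioVitek2026, Lemma 3.2] -/
def tubeStageMap (r ρ : ℝ) (T : E × F → E) (N : E × F → F) (Ψ : ℝ → E × F → F) (lam : ℝ → ℝ)
    (p : E × F) : E × F :=
  if r / 2 ≤ ‖p.2‖ then flattenStageMap T N (flattenCutoff r) p
  else if r / 4 ≤ ‖p.2‖ then coneifyStageMap N (stagePacing r) p
  else if r / 8 ≤ ‖p.2‖ then roundStageMap N (r / 4) ρ (roundCutoff r) p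
  else radialStageMap ρ Ψ lam p

variable {r ρ : ℝ} {T : E × F → E} {N : E × F → F} {Ψ : ℝ → E × F → F} {lam : ℝ → ℝ}
  {V : Set E} {p : E × F}

/-! #### Which formula on which zone -/

/-- On `t ≥ r/2` the stage map is the flattened map. [folklore] -/
theorem tubeStageMap_of_half_le (h : r / 2 ≤ ‖p.2‖) :
    tubeStageMap r ρ T N Ψ lam p = flattenStageMap T N (flattenCutoff r) p := by
  rw [tubeStageMap, if_pos h]

/-- On `r/4 ≤ t < r/2` the stage map is the cone-ified map. [folklore] -/
theorem tubeStageMap_of_quarter_le (h₁ : r / 4 ≤ ‖p.2‖) (h₂ : ‖p.2‖ < r / 2) :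
    tubeStageMap r ρ T N Ψ lam p = coneifyStageMap N (stagePacing r) p := by
  rw [tubeStageMap, if_neg (not_le.2 h₂), if_pos h₁]

/-- On `r/8 ≤ t < r/4` the stage map is the rounded map. [folklore] -/
theorem tubeStageMap_of_eighth_le (h₁ : r / 8 ≤ ‖p.2‖) (h₂ : ‖p.2‖ < r / 4) (_hr : 0 < r) :
    tubeStageMap r ρ T N Ψ lam p = roundStageMap N (r / 4) ρ (roundCutoff r) p := by
  rw [tubeStageMap, if_neg (not_le.2 (by linarith)), if_neg (not_le.2 h₂), if_pos h₁]

/-- On `t < r/8` the stage map is the radial stage map. [folklore] -/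
theorem tubeStageMap_of_lt_eighth (h : ‖p.2‖ < r / 8) (hr : 0 < r) :
    tubeStageMap r ρ T N Ψ lam p = radialStageMap ρ Ψ lam p := by
  rw [tubeStageMap, if_neg (not_le.2 (by linarith)), if_neg (not_le.2 (by linarith)), if_neg (not_le.2 h)]

/-! #### Plateau values -/

/-- **Far out the stage map is `u`**: for `t ≥ 7r/8`, `Φ p = (T p, N p)`. [folklore] -/
theorem tubeStageMap_of_ge (hr : 0 < r) (h : 7 * r / 8 ≤ ‖p.2‖) :
    tubeStageMap r ρ T N Ψ lam p = (T p, N p) := by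
  rw [tubeStageMap_of_half_le (by linarith), flattenStageMap_of_eta_eq_one (flattenCutoff_of_ge hr h)]

/-- On `[7r/16, 5r/8]` the stage map is `(x, N p)` (both the flatten and the cone-ify formula).
[folklore] -/
theorem tubeStageMap_eq_graph (hr : 0 < r) (h₁ : 7 * r / 16 ≤ ‖p.2‖) (h₂ : ‖p.2‖ ≤ 5 * r / 8) :
    tubeStageMap r ρ T N Ψ lam p = (p.1, N p) := by
  by_cases h : r / 2 ≤ ‖p.2‖
  · rw [tubeStageMap_of_half_le h, flattenStageMap_of_eta_eq_zero (flattenCutoff_of_le hr h₂)]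
  · have hp : p.2 ≠ 0 := by
      intro h0; rw [h0, norm_zero] at h₁; linarith
    rw [tubeStageMap_of_quarter_le (by linarith) (not_le.1 h), coneifyStageMap,
      coneifyMap_of_eq_self hp (stagePacing_of_ge hr h₁)]

/-- On `[7r/32, 5r/16]` the stage map is the exact cone `(x, t • V p)`, `V = linkField N (r/4)`
(both the cone-ify and the round formula). [folklore] -/
theorem tubeStageMap_eq_cone (hr : 0 < r) (h₁ : 7 * r / 32 ≤ ‖p.2‖) (h₂ : ‖p.2‖ ≤ 5 * r / 16) :
    tubeStageMap r ρ T N Ψ lam p = (p.1, ‖p.2‖ • linkField N (r / 4) p) := by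
  have hp : p.2 ≠ 0 := by
    intro h0; rw [h0, norm_zero] at h₁; linarith
  by_cases h : r / 4 ≤ ‖p.2‖
  · rw [tubeStageMap_of_quarter_le h (by linarith), coneifyStageMap,
      coneifyMap_of_eq_const (stagePacing_of_le hr h₂)]
    rfl
  · rw [tubeStageMap_of_eighth_le (by linarith) (not_le.1 h) hr, roundStageMap,
      roundMap_of_eta_eq_one (roundCutoff_of_ge hr h₁)]

/-- On `[r/8, 5r/32]` the stage map is the round cone `(x, (ρ t) • V/‖V‖)`. [folklore] -/
theorem tubeStageMap_eq_roundCone (hr : 0 < r) (h₁ : r / 8 ≤ ‖p.2‖) (h₂ : ‖p.2‖ ≤ 5 * r / 32) :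
    tubeStageMap r ρ T N Ψ lam p =
      (p.1, (ρ * ‖p.2‖) • (‖linkField N (r / 4) p‖⁻¹ • linkField N (r / 4) p)) := by
  rw [tubeStageMap_of_eighth_le h₁ (by linarith) hr, roundStageMap,
    roundMap_of_eta_eq_zero (roundCutoff_of_le hr h₂)]

/-- On `[3r/32, r/8)` (where `λ = 2` and the unit family is the link direction) the stage map is
the same round cone. [folklore] -/
theorem tubeStageMap_eq_roundCone' (hr : 0 < r) (hlam2 : ∀ t, 3 * r / 32 ≤ t → lam t = 2)
    (hΨ2 : ∀ s : ℝ, 2 ≤ s → ∀ q : E × F, q ∈ radialDomain V →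
      Ψ s q = ‖linkField N (r / 4) q‖⁻¹ • linkField N (r / 4) q)
    (hp1 : p.1 ∈ V) (h₁ : 3 * r / 32 ≤ ‖p.2‖) (h₂ : ‖p.2‖ < r / 8) :
    tubeStageMap r ρ T N Ψ lam p =
      (p.1, (ρ * ‖p.2‖) • (‖linkField N (r / 4) p‖⁻¹ • linkField N (r / 4) p)) := by
  have hp : p.2 ≠ 0 := by
    intro h0; rw [h0, norm_zero] at h₁; linarith
  rw [tubeStageMap_of_lt_eighth h₂ hr, radialStageMap, radialFamilyMap, hlam2 _ h₁,
    hΨ2 2 le_rfl p ⟨hp1, hp⟩]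

/-! #### Local agreement on open annuli and zones -/

omit [NormedSpace ℝ E] [InnerProductSpace ℝ F] in
/-- Open annuli are neighbourhoods of their points. [folklore] -/
private theorem annulus_mem_nhds {a b : ℝ} (ha : a < ‖p.2‖) (hb : ‖p.2‖ < b) :
    {q : E × F | a < ‖q.2‖ ∧ ‖q.2‖ < b} ∈ 𝓝 p :=
  ((isOpen_lt continuous_const (continuous_norm.comp continuous_snd)).inter
    (isOpen_lt (continuous_norm.comp continuous_snd) continuous_const)).mem_nhds ⟨ha, hb⟩

/-- Near a point of the open flatten zone `t > r/2` the stage map is the flattened map.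
[folklore] -/
theorem tubeStageMap_eventuallyEq_flatten (h : r / 2 < ‖p.2‖) :
    tubeStageMap r ρ T N Ψ lam =ᶠ[𝓝 p] flattenStageMap T N (flattenCutoff r) := by
  filter_upwards [(isOpen_lt continuous_const (continuous_norm.comp continuous_snd)).mem_nhds h]
    with q hq
  exact tubeStageMap_of_half_le (le_of_lt hq)

/-- Near a point of the open cone-ify zone `r/4 < t < r/2` the stage map is the cone-ified map.
[folklore] -/
theorem tubeStageMap_eventuallyEq_coneify (h₁ : r / 4 < ‖p.2‖) (h₂ : ‖p.2‖ < r / 2) :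
    tubeStageMap r ρ T N Ψ lam =ᶠ[𝓝 p] coneifyStageMap N (stagePacing r) := by
  filter_upwards [annulus_mem_nhds h₁ h₂] with q hq
  exact tubeStageMap_of_quarter_le hq.1.le hq.2

/-- Near a point of the open round zone `r/8 < t < r/4` the stage map is the rounded map.
[folklore] -/
theorem tubeStageMap_eventuallyEq_round (hr : 0 < r) (h₁ : r / 8 < ‖p.2‖) (h₂ : ‖p.2‖ < r / 4) :
    tubeStageMap r ρ T N Ψ lam =ᶠ[𝓝 p] roundStageMap N (r / 4) ρ (roundCutoff r) := by
  filter_upwards [annulus_mem_nhds h₁ h₂] with q hq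
  exact tubeStageMap_of_eighth_le hq.1.le hq.2 hr

/-- Near a point of the open radial zone `t < r/8` the stage map is the radial stage map.
[folklore] -/
theorem tubeStageMap_eventuallyEq_radial (hr : 0 < r) (h : ‖p.2‖ < r / 8) :
    tubeStageMap r ρ T N Ψ lam =ᶠ[𝓝 p] radialStageMap ρ Ψ lam := by
  filter_upwards [(isOpen_lt (continuous_norm.comp continuous_snd) continuous_const).mem_nhds h]
    with q hq
  exact tubeStageMap_of_lt_eighth hq hr

/-- Near a point of the overlap annulus `(7r/16, 5r/8)` the stage map is `(x, N)`. [folklore] -/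
theorem tubeStageMap_eventuallyEq_graph (hr : 0 < r) (h₁ : 7 * r / 16 < ‖p.2‖) (h₂ : ‖p.2‖ < 5 * r / 8) :
    tubeStageMap r ρ T N Ψ lam =ᶠ[𝓝 p] fun q => (q.1, N q) := by
  filter_upwards [annulus_mem_nhds h₁ h₂] with q hq
  exact tubeStageMap_eq_graph hr hq.1.le hq.2.le

/-- Near a point of the overlap annulus `(7r/32, 5r/16)` the stage map is the exact cone.
[folklore] -/
theorem tubeStageMap_eventuallyEq_cone (hr : 0 < r) (h₁ : 7 * r / 32 < ‖p.2‖) (h₂ : ‖p.2‖ < 5 * r / 16) :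
    tubeStageMap r ρ T N Ψ lam =ᶠ[𝓝 p] fun q => (q.1, ‖q.2‖ • linkField N (r / 4) q) := by
  filter_upwards [annulus_mem_nhds h₁ h₂] with q hq
  exact tubeStageMap_eq_cone hr hq.1.le hq.2.le

/-- Near a point of the overlap annulus `(3r/32, 5r/32)` over `V` the stage map is the round
cone. [folklore] -/
theorem tubeStageMap_eventuallyEq_roundCone (hr : 0 < r) (hV : IsOpen V)
    (hlam2 : ∀ t, 3 * r / 32 ≤ t → lam t = 2)
    (hΨ2 : ∀ s : ℝ, 2 ≤ s → ∀ q : E × F, q ∈ radialDomain V →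
      Ψ s q = ‖linkField N (r / 4) q‖⁻¹ • linkField N (r / 4) q)
    (hp1 : p.1 ∈ V) (h₁ : 3 * r / 32 < ‖p.2‖) (h₂ : ‖p.2‖ < 5 * r / 32) :
    tubeStageMap r ρ T N Ψ lam =ᶠ[𝓝 p]
      fun q => (q.1, (ρ * ‖q.2‖) • (‖linkField N (r / 4) q‖⁻¹ • linkField N (r / 4) q)) := by
  filter_upwards [annulus_mem_nhds h₁ h₂, (hV.preimage continuous_fst).mem_nhds hp1] with q hq hq1
  by_cases h : r / 8 ≤ ‖q.2‖
  · exact tubeStageMap_eq_roundCone hr h hq.2.le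
  · exact tubeStageMap_eq_roundCone' hr hlam2 hΨ2 hq1 hq.1.le (not_le.1 h)

/-! ### Smoothness of the assembled map -/

/-- `∞ ≠ 0` (bookkeeping). [folklore] -/
private theorem stage_infty_ne_zero : (∞ : WithTop ℕ∞) ≠ 0 := by
  simp

omit [NormedAddCommGroup E] [NormedSpace ℝ E] in
/-- The link field of the stage does not vanish where `N` does not vanish on the sphere bundle of
radius `r/4`. [folklore] -/
theorem linkField_ne_zero (hr : 0 < r) (hN0 : ∀ q : E × F, q.1 ∈ V → ‖q.2‖ = r / 4 → N q ≠ 0)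
    (hp1 : p.1 ∈ V) (hp : p.2 ≠ 0) : linkField N (r / 4) p ≠ 0 := by
  rw [linkField_eq]
  refine smul_ne_zero (inv_ne_zero (by linarith)) (hN0 _ hp1 ?_)
  exact norm_linkPoint_snd hp (by linarith)

/-- **Smoothness of the tube stage map** on `V × B(0, r)`.  Hypotheses: `r > 0`, `V` open;
`N` is `C^∞` at every point of the closed shell `r/4 ≤ ‖y‖ ≤ r` over `V` and nonzero on the
sphere bundle `‖y‖ = r/4`; `T` is `C^∞` on `5r/8 ≤ ‖y‖ ≤ r`; the unit family `Ψ` is jointly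
`C^∞` off the zero section over `V`, equals the link direction `V/‖V‖` for parameters `s ≥ 2`,
and is the rigid map `R ∘ (y ↦ y/‖y‖)` at `s = 0`; the pacing `λ` is smooth on `t > 0`, equals
`2` on `[3r/32, ∞)` and `0` on `(−∞, t₀]`, `t₀ > 0`. [folklore] -/
theorem contDiffAt_tubeStageMap (hr : 0 < r) (hV : IsOpen V)
    (hN : ∀ q : E × F, q.1 ∈ V → r / 4 ≤ ‖q.2‖ → ‖q.2‖ ≤ r → ContDiffAt ℝ ∞ N q)
    (hT : ∀ q : E × F, q.1 ∈ V → 5 * r / 8 ≤ ‖q.2‖ → ‖q.2‖ ≤ r → ContDiffAt ℝ ∞ T q)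
    (hN0 : ∀ q : E × F, q.1 ∈ V → ‖q.2‖ = r / 4 → N q ≠ 0)
    (hΨ : ∀ s : ℝ, ∀ q : E × F, q ∈ radialDomain V → ContDiffAt ℝ ∞ (uncurry Ψ) (s, q))
    (hΨ2 : ∀ s : ℝ, 2 ≤ s → ∀ q : E × F, q ∈ radialDomain V →
      Ψ s q = ‖linkField N (r / 4) q‖⁻¹ • linkField N (r / 4) q)
    {R : F →ₗᵢ[ℝ] F} {t₀ : ℝ} (ht₀ : 0 < t₀)
    (hΨ0 : ∀ q : E × F, q ∈ radialDomain V → Ψ 0 q = R (‖q.2‖⁻¹ • q.2))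
    (hlam : ∀ t : ℝ, 0 < t → ContDiffAt ℝ ∞ lam t) (hlam2 : ∀ t, 3 * r / 32 ≤ t → lam t = 2)
    (hlam0 : ∀ t ≤ t₀, lam t = 0)
    (hp1 : p.1 ∈ V) (hpr : ‖p.2‖ < r) : ContDiffAt ℝ ∞ (tubeStageMap r ρ T N Ψ lam) p := by
  -- notation and elementary facts
  have hVF : ∀ q : E × F, q.1 ∈ V → q.2 ≠ 0 → linkField N (r / 4) q ≠ 0 := fun q hq1 hq =>
    linkField_ne_zero hr hN0 hq1 hq
  have hNlink : ∀ q : E × F, q.1 ∈ V → q.2 ≠ 0 → ContDiffAt ℝ ∞ N (linkPoint (r / 4) q) := by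
    intro q hq1 hq
    refine hN _ hq1 ?_ ?_ <;> rw [norm_linkPoint_snd hq (by linarith)] ; linarith
  have hlinkV : ∀ q : E × F, q.1 ∈ V → q.2 ≠ 0 → ContDiffAt ℝ ∞ (linkField N (r / 4)) q :=
    fun q hq1 hq => contDiffAt_linkField hq (hNlink q hq1 hq)
  set t : ℝ := ‖p.2‖ with ht
  -- case analysis on the radius
  rcases lt_or_ge t (r / 8) with h8 | h8
  · -- radial zone
    refine ContDiffAt.congr_of_eventuallyEq ?_ (tubeStageMap_eventuallyEq_radial hr h8)
    rcases lt_or_ge t t₀ with h0 | h0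
    · exact contDiffAt_radialStageMap_core hV hlam0 hΨ0 hp1 h0
    · have hp : p.2 ≠ 0 := by
        intro h; rw [ht, h, norm_zero] at h0; linarith
      exact contDiffAt_radialStageMap hp (hΨ _ p ⟨hp1, hp⟩) (hlam t (norm_pos_iff.2 hp))
  have hp : p.2 ≠ 0 := by
    intro h; rw [ht, h, norm_zero] at h8; linarith
  rcases lt_or_ge t (5 * r / 32) with h532 | h532
  · -- overlap: round cone
    refine ContDiffAt.congr_of_eventuallyEq ?_
      (tubeStageMap_eventuallyEq_roundCone hr hV hlam2 hΨ2 hp1 (by linarith) h532)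
    have hn : ContDiffAt ℝ ∞ (fun q : E × F => ‖q.2‖) p := (contDiffAt_norm ℝ hp).comp p contDiffAt_snd
    have hVs := hlinkV p hp1 hp
    have hβ : ContDiffAt ℝ ∞ (fun q : E × F => ‖linkField N (r / 4) q‖⁻¹) p :=
      (hVs.norm ℝ (hVF p hp1 hp)).inv (norm_ne_zero_iff.2 (hVF p hp1 hp))
    exact contDiffAt_fst.prodMk ((contDiffAt_const.mul hn).smul (hβ.smul hVs))
  rcases lt_or_ge t (r / 4) with h4 | h4
  · -- round zone
    refine ContDiffAt.congr_of_eventuallyEq ?_ (tubeStageMap_eventuallyEq_round hr (by linarith) h4)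
    exact contDiffAt_roundStageMap hp (hNlink p hp1 hp) (hVF p hp1 hp)
      (contDiff_roundCutoff r).contDiffAt
  rcases lt_or_ge t (5 * r / 16) with h516 | h516
  · -- overlap: exact cone
    refine ContDiffAt.congr_of_eventuallyEq ?_ (tubeStageMap_eventuallyEq_cone hr (by linarith) h516)
    have hn : ContDiffAt ℝ ∞ (fun q : E × F => ‖q.2‖) p := (contDiffAt_norm ℝ hp).comp p contDiffAt_snd
    exact contDiffAt_fst.prodMk (hn.smul (hlinkV p hp1 hp))
  rcases lt_or_ge t (r / 2) with h2 | h2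
  · -- cone-ify zone
    refine ContDiffAt.congr_of_eventuallyEq ?_ (tubeStageMap_eventuallyEq_coneify (by linarith) h2)
    have hμ := stagePacing_mem_Icc (r := r) h4
    refine contDiffAt_coneifyStageMap hp (hN _ hp1 ?_ ?_) (contDiff_stagePacing r).contDiffAt
      (stagePacing_pos hr h4).ne'
    · rw [norm_coneifyPoint_snd hp (stagePacing_pos hr h4).le]; exact hμ.1
    · rw [norm_coneifyPoint_snd hp (stagePacing_pos hr h4).le]; linarith [hμ.2]
  rcases lt_or_ge t (5 * r / 8) with h58 | h58
  · -- overlap: graph of `N`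
    refine ContDiffAt.congr_of_eventuallyEq ?_ (tubeStageMap_eventuallyEq_graph hr (by linarith) h58)
    exact contDiffAt_fst.prodMk (hN p hp1 (by linarith) hpr.le)
  · -- flatten zone
    refine ContDiffAt.congr_of_eventuallyEq ?_ (tubeStageMap_eventuallyEq_flatten (by linarith))
    exact contDiffAt_flattenStageMap hp (hT p hp1 h58 hpr.le) (hN p hp1 (by linarith) hpr.le)
      (contDiff_flattenCutoff r).contDiffAt

end Literature.Topology.FourManifolds
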